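import Literature.IUT.HodgeArakelov.BadPrimeGaussianMonoidsRecordOrbitProofs
import Literature.IUT.HodgeArakelov.IotaInvariantThetaInfty

/-!
# [IUTchII] Cor 3.5 (ii) at the `∞`-level — print's ROOT CONDITION `hroots` («some positive power coincides, up to
# torsion, with an element of `θ`», Prop 1.4 p. 27) HOLDS for the record produced by the bridge (proof-only)

S. Mochizuki, *Inter-universal Teichmüller theory II*, kurims Dec-2020 manuscript, Prop 1.4 p. 27, Prop 2.2 (ii) p. 66,
Cor 3.5 (ii) p. 95 [cite: Mochizuki2012, Prop 1.4 p.27]. Claim key DISPUTED (D-0012). PROOF-ONLY companion (abc-iut cell,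
layer L6, seat abc-iut-w4-d004 gen 2; node **IUTchII:Cor3.5(ii)**, `∞`-level junction hypothesis `hroots` of
`…SyncInftyTorsionProofs` / `…GenuineRecordInftyProofs`; companion of `…RecordOrbitProofs` (`horb_toRecord`)). NO definition,
NO `Prop` fact.

For the `ThetaEnvData` record `T'.toRecord act κ iota` produced by abc-iut-w4-d019's bridge from the cohomological theta data
`T'` (so `θ^{i}_env = envSet (θ^ι read in the limit)`, `∞θ^{i}_env = envSet (∞θ^ι)`), with the inversion of label `i₀` equal to
the `ι`-action `Θ.iotaLim` of abc-iut-w5-d187's Prop 2.2 (ii)′ data `Θ : IotaInvariantTheta'`: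
* `exists_torsion_mul_eq_pow_of_mem_toRecord_inftyThetaEnv` — every `ϑ ∈ ∞θ^{i₀}_env` has a positive power `ϑ^N = τ·θ` with
  `τ` TORSION, for any `θ ∈ θ^{i₀}_env`: an `N`-th root `x` of a class `t ∈ θ(Π_v)` that is `ι`-invariant up to torsion forces
  `t` to be `ι`-invariant up to torsion (abc-iut-w5-d187 `isOfFinAddOrder_iotaH1_sub_of_root`, given `hker`: `Ker(H¹ → lim)` is
  torsion), and two such classes differ by `2l`-torsion (`Θ.thetaIota_orbit`);
* `hroots_toRecord` — hence print's root condition in the shape consumed by the `∞`-level files: `∀ ϑ ∈ ∞θ^{i₀}_env,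
  ∃ N > 0, ϑ^N ∈ M^×_TM · θ^ℕ`, given `htors` (`M^μ_TM ⊆ M^×_TM`, Cor 1.12 p. 57) — the SAME inputs as `horb_toRecord`.

Nothing here asserts a disputed claim or takes a side on [IUTchIII] Cor 3.12; typed ≠ proved ≠ endorsed.
-/

namespace Literature.IUT.HodgeArakelov

namespace BadPrimeGaussianMonoids

universe u

variable {S' : BadPlaceSetting.{u}} {F' : ModelFamily S'.toThetaSetting} {Sys' : MonoThetaProjSystem F'}
  (T' : ThetaEnvData Sys') {Tc : TemperedCoverings S' Sys'.PiX} {Dec : SubgraphDecomposition S' Tc T'.D}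
  (Θ : IotaInvariantTheta' Dec) (act : Sys'.PiX →* MulAut (Multiplicative T'.cohEnv.lim)) {M : Type u}
  [CommMonoid M] (κ : M →* Multiplicative T'.cohEnv.lim) {Iota : Type u}
  (iota : Iota → (T'.D.coh.lim ≃+ T'.D.coh.lim))

/-- **IUTchII:Prop1.4** / **Prop2.2(ii)** (kurims p.27, p.66) for the produced record: every `ϑ ∈ ∞θ^{i₀}_env` has a positive
power equal to a TORSION multiple of any given `θ ∈ θ^{i₀}_env` — `ϑ^N = τ · θ`, `IsOfFinOrder τ` — when the inversion of
label `i₀` is `Θ.iotaLim` and `Ker(H¹(Π_Ÿ) → lim)` is torsion. [cite: Mochizuki2012, Prop 2.2 (ii) p.66] -/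
theorem exists_torsion_mul_eq_pow_of_mem_toRecord_inftyThetaEnv
    (hker : ∀ y : T'.D.coh.H1 ⊤, T'.D.coh.toLim ⊤ y = 0 → IsOfFinAddOrder y) {i₀ : Iota}
    (hi₀ : iota i₀ = Θ.iotaLim) {θ ϑ : Multiplicative T'.cohEnv.lim}
    (hθ : θ ∈ (T'.toRecord act κ iota).thetaEnv i₀) (hϑ : ϑ ∈ (T'.toRecord act κ iota).inftyThetaEnv i₀) :
    ∃ (N : ℕ) (τ : Multiplicative T'.cohEnv.lim), 0 < N ∧ IsOfFinOrder τ ∧ ϑ ^ N = τ * θ := by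
  obtain ⟨t₀, ht₀, hθeq⟩ := exists_thetaIota_of_mem_toRecord_thetaEnv T' Θ act κ iota hker hi₀ hθ
  have h1 := (ThetaEnvData.mem_envSet_iff T' (T'.thetaInftyIotaLim (iota i₀)) ϑ).mp hϑ
  rw [hi₀, ThetaEnvData.mem_thetaInftyIotaLim_iff] at h1
  set x : T'.D.coh.lim := T'.transportLim.symm (Multiplicative.toAdd ϑ) with hxdef
  have hx : x ∈ Θ.thetaInftyIota := h1
  obtain ⟨N, hN, t, ht, hroot⟩ := (T'.D.mem_thetaInfty_iff_exists_level x).mp h1.1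
  -- `t` is `ι`-invariant up to torsion, hence differs from `t₀` by `2l`-torsion
  have hιt : IsOfFinAddOrder (Θ.iotaH1 t - t) := Θ.isOfFinAddOrder_iotaH1_sub_of_root hker hx hroot
  have horb : (2 * S'.l) • (t - t₀) = 0 := Θ.thetaIota_orbit t₀ ht₀.1 t ht ht₀.2 hιt
  have htt₀ : IsOfFinAddOrder (T'.D.coh.toLim ⊤ t - T'.D.coh.toLim ⊤ t₀) := by
    rw [← map_sub]
    exact (T'.D.coh.toLim ⊤).isOfFinAddOrder
      (isOfFinAddOrder_iff_nsmul_eq_zero.2 ⟨2 * S'.l, Nat.mul_pos two_pos S'.l_prime.pos, horb⟩)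
  have hNx : IsOfFinAddOrder (N • x - T'.D.coh.toLim ⊤ t₀) := by
    have hsum := hroot.add htt₀
    rwa [sub_add_sub_cancel] at hsum
  refine ⟨N, Multiplicative.ofAdd (T'.transportLim (N • x - T'.D.coh.toLim ⊤ t₀)), hN, ?_, ?_⟩
  · exact isOfFinOrder_ofAdd_iff.mpr (T'.transportLim.toAddMonoidHom.isOfFinAddOrder hNx)
  · apply Multiplicative.toAdd.injective
    rw [toAdd_pow, toAdd_mul, toAdd_ofAdd, hθeq, ← map_add, sub_add_cancel, map_nsmul, hxdef,
      AddEquiv.apply_symm_apply]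

/-- **IUTchII:Cor3.5(ii)** `∞`-level junction hypothesis `hroots` HOLDS for the produced record: every generator
`ϑ ∈ ∞θ^{i₀}_env(M^Θ_*)` has a positive power in `M^×_TM · θ^ℕ` (`θ ∈ θ^{i₀}_env` fixed), given `M^μ_TM ⊆ M^×_TM` (`htors`,
Cor 1.12 p. 57), the inversion of label `i₀` being `Θ.iotaLim`, and `Ker(H¹(Π_Ÿ) → lim)` torsion — the same inputs as
`horb_toRecord`. [cite: Mochizuki2012, Cor 3.5 (ii) p.95] -/
theorem hroots_toRecord
    (hker : ∀ y : T'.D.coh.H1 ⊤, T'.D.coh.toLim ⊤ y = 0 → IsOfFinAddOrder y) {i₀ : Iota}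
    (hi₀ : iota i₀ = Θ.iotaLim)
    (htors : ∀ u : (T'.toRecord act κ iota).H, IsOfFinOrder u → u ∈ (T'.toRecord act κ iota).units)
    {θ : (T'.toRecord act κ iota).H} (hθ : θ ∈ (T'.toRecord act κ iota).thetaEnv i₀) :
    ∀ ϑ ∈ (T'.toRecord act κ iota).inftyThetaEnv i₀, ∃ N : ℕ, 0 < N ∧
      ϑ ^ N ∈ TemperedThetaMonoids.splitMonoid (T'.toRecord act κ iota).units (Submonoid.powers θ) := by
  intro ϑ hϑ
  obtain ⟨N, τ, hN, hτ, h⟩ :=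
    exists_torsion_mul_eq_pow_of_mem_toRecord_inftyThetaEnv T' Θ act κ iota hker hi₀ hθ hϑ
  exact ⟨N, hN, (TemperedThetaMonoids.mem_splitMonoid_iff _ _ _).mpr
    ⟨τ, htors τ hτ, θ, Submonoid.mem_powers θ, h.symm⟩⟩

end BadPrimeGaussianMonoids

end Literature.IUT.HodgeArakelov
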